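import Summits.QuantumFields.BalabanUV.Beta.D1BFx.GhostKernelRooted
import Summits.QuantumFields.BalabanUV.Beta.D1BFx.GhostAveragingSquare

/-!
# `BalabanUV.Beta.D1BFx.GhostKernelComplete` — road «BF-x» for binder row D1, sub-leaf T7-gh v1.2: THE COMPLETED GHOST FINE ONE-SHOT
# KERNEL `PghQ n a x₀ cK cQ := TOfGh n a (SghAt (ctrHalf n) n cK cQ) (tableRedF n (WghAt (ctrHalf n) n x₀ cK cQ))` — leaf-04's T7-gh v1.1
# triple (`GhostKernelRooted`) WITH the averaging square (`GhostAveragingSquare.WghAt`) in the table slot: well-typed for every block size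
# (`0 < a` only), an `ℋ`-sandwich, and ON THE WARD RAY `(x₀, cK, cQ) = (−c, c·n², c·a)` its A4 / K-R5 moment transfer holds with NO
# hypothesis beyond `Odd n`, `0 < a` — Ward rows AND parity are theorems for this triple

HONEST DEPENDENCY (page 1, mandatory): continuum YM on T⁴ ⇐ BetaPertH ∧ nine spine estimates (0/9 proved); BetaPertH ⇐ (D1) ∧ (D4) ∧
CAP+tail; G-an2-4 gates asym, D1 and NE2/3/4.  HONEST FRAMING (cell contract, verbatim): «discharging `BetaPertH` makes Bałaban's UV
stability UNCONDITIONAL — a real constructive-QFT result; it is NOT the continuum limit and NOT the Clay problem.»  THIS MODULE DISCHARGES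
NOTHING of the wall: two definitions with bodies ([our objects] `PghQ`, `fineHessGhQ` — asserting nothing) and [folklore] bookkeeping BY
NAME over leaf-04-g2's `GhostKernelRooted` (its GENERIC-TABLE §2 `bondSecondMoment_TOfGh_ctr_eq_avgM2_of_tableLaw` / `_of_laws`, its sockets
`biLoc_SghAt_ctr` / `SghAt_ctr_translate_block`), this seat's `GhostAveragingSquare` (`WghAt`, `biLoc_WghAt`, `WghAt_symm`, `WghAt_translate`,
`WghAt_pointInversion`, `ward₂_WghAt`, `hasSum_row_fineHessA_ghost`), leaf-04's T7-gh/T8-gh chain (`ReducedKernelF.TOfGh` /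
`absMoment₂_TOfGh` / `vertexFamily_vertexRedF'`, `ReducedTableF.vertexFamily₂_tableRedF'` / `tableRedF_translate`,
`GhostKernel.vertexRedF_translate_block`, `ReducedKernelSandwichBlock.TOfLeg_tableRedF_eq_dressedEntryP_of_block`), the typer's ghost leg
(`GhostLeg.spr_Ggh` / `shiftK_Ggh_neg` / `decays_Ggh`).  No `def … : Prop`, no citation, nothing printed asserted; 0 binders of the hR root
touched; 0 sorry.  NOT summit progress; NOT BetaPertH, NOT continuum, NOT Clay.
ABSOLUTE RULE (cell, verbatim): «No internally-minted statement may enter as a cited fact. Every hypothesis is either kernel-proved in this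
package or a verbatim quotation of a PUBLISHED theorem with page reference. The manuscript(s) under audit are NOT citable for their own
disputed steps — they are the thing under adjudication; programme-internal (2001/route/tribunal) claims are never citable.»

WHY (owner `OWNER-RULINGS-1.md` R-4 (iii)/(iv) + the open ruling asked in journal l.12464: does T7-gh OF RECORD take the averaging-square
slot?).  Leaf-04-g2's `PghR` (T7-gh v1.1) is the ruled kinetic-only literal, for which the Ward rows `hrow` stay the named A3.b hypothesis at
`cQ ≠ 0`; this seat's `WghAt` completes the table so that (W2) holds against the full stencil.  This file packages the completed triple as
ONE kernel `PghQ` in leaf-04's format, so that node A0 / A7 can consume the ghost sector with `hrow` and parity DISCHARGED — whichever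
kernel the owner declares of record, both are in the tree and share every generic theorem.

CONTENT.
* §1 [our objects] `PghQ`, `fineHessGhQ`; unfoldings (`PghQ_eq`, `PghQ_eq_TOfLeg`, `PghQ_eq_hessKer`, `fineHessGhQ_eq`); the completed
  table's sockets at the centred root (`biLoc_WghAt_ctr`, `WghAt_ctr_translate_block`, `WghAt_ctr_pointInversion`).
* §2 [folklore] T7 WELL-TYPEDNESS in leaf-04's format: `blockCovariant_PghQ`, `hess_eq_PghQ`, `exists_vertexFamily₂_WghAt`,
  **`absMoment₂_PghQ`**, **`exists_decay510_PghQ`** (`0 < a`; NO other hypothesis; constants per `n`); `PghQ_eq_dressedEntryP`.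
* §3 [folklore] the ENDs: `bondSecondMoment_PghQ_eq_avgM2_of_wardRows` (ALL weights, `Odd n`: parity discharged, `hrow` the only
  hypothesis — ONE application of leaf-04-g2's `…_of_tableLaw` at `Wf := WghAt`); on the WARD RAY: `hasSum_row_fineHessGhQ_ray` and
  **`bondSecondMoment_PghQ_ray_eq_avgM2 (hodd : Odd n) (ha : 0 < a) (c : ℝ)`** — NO other hypothesis — proved through leaf-04-g2's
  `…_of_laws` with `hW2 := ward₂_WghAt` (the second kernel route to `GhostAveragingSquare.bondSecondMoment_TOfGh_eq_avgM2_ghost`; the two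
  agree by `PghQ_ray_eq_ghost`), and `secondMoment_PghQ_ray_eq` in `B12Beta.secondMoment` currency (`n⁻⁸·avgM2`).
Unit `b2b-balaban-beta-d1-formalise-leaf-02` (gen 2).
-/

noncomputable section

namespace Summit.QuantumFields.BalabanUV.Beta.D1BFx.GhostKernelComplete

open Finset
open scoped BigOperators
open Literature.MathematicalPhysics.QuantumFieldTheory.Balaban1983to89
open Literature.MathematicalPhysics.QuantumFieldTheory.Balaban1983to89.Beta
open B12Sec2to5 (l1 l1_nonneg Decay510)
open B6QGQDecay237 (deltaU deltaU_pos)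
open ExpKernelCalculus (Site MKer Decays BiLoc VertexFamily VertexFamily₂ comp shiftK BlockCovariant hess hessKer hess_eq_hessKer
  hdec_hessKer)
open DecimatedMomentSummable (AbsMoment₂)
open MinimiserIdentityForm (wK)
open KernelReflection (LegMap refK)
open KernelWard (divW)
open OneStepResolventKernel (decays_mono biLoc_mono)
open Summit.QuantumFields.BalabanUV.Beta.D1BFx.GhostLeg (Ggh spr_Ggh shiftK_Ggh_neg decays_Ggh const_nonneg)
open Summit.QuantumFields.BalabanUV.Beta.D1BFx.GhostLegReflection (invLeg refK_invLeg_Ggh)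
open Summit.QuantumFields.BalabanUV.Beta.D1BFx.GhostStencilReflection (cInv)
open Summit.QuantumFields.BalabanUV.Beta.D1BFx.GhostStencilRooted (SghAt)
open Summit.QuantumFields.BalabanUV.Beta.D1BFx.GhostStencilRootedReflection (ctrHalf ctrHalf_mem)
open Summit.QuantumFields.BalabanUV.Beta.D1BFx.GhostStencilWard (genX)
open Summit.QuantumFields.BalabanUV.Beta.D1BFx.ReducedKernelF (vertexRedF TOfLeg TOfGh vertexFamily_vertexRedF' absMoment₂_TOfGh)
open Summit.QuantumFields.BalabanUV.Beta.D1BFx.ReducedTableF (tableRedF vertexFamily₂_tableRedF' tableRedF_translate)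
open Summit.QuantumFields.BalabanUV.Beta.D1BFx.GhostKernel (vertexRedF_translate_block)
open Summit.QuantumFields.BalabanUV.Beta.D1BFx.MomentTransferPeriodicEntry (EKer₂ dressedEntryP avgM2)
open Summit.QuantumFields.BalabanUV.Beta.D1BFx.ReducedKernelSandwichLeg (fineHessA)
open Summit.QuantumFields.BalabanUV.Beta.D1BFx.ReducedKernelSandwichBlock (TOfLeg_tableRedF_eq_dressedEntryP_of_block)
open Summit.QuantumFields.BalabanUV.Beta.D1BFx.GhostKernelRooted (biLoc_SghAt_ctr SghAt_ctr_translate_block exists_vertexFamily_SghAt_ctr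
  bondSecondMoment_TOfGh_ctr_eq_avgM2_of_tableLaw bondSecondMoment_TOfGh_ctr_eq_avgM2_of_laws)
open Summit.QuantumFields.BalabanUV.Beta.D1BFx.GhostAveragingSquare (WghAt biLoc_WghAt WghAt_symm WghAt_translate WghAt_pointInversion
  ward₂_WghAt hasSum_row_fineHessA_ghost bondSecondMoment_TOfGh_eq_avgM2_ghost)

/-! ## §1 The completed kernel and the completed table's sockets at the centred root -/

/-- [our object] **T7-gh v1.2 — THE COMPLETED GHOST FINE ONE-SHOT KERNEL** at block size `n`, averaging weight `a`, generator weight `x₀`,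
stencil weights `cK cQ`: `PghQ n a x₀ cK cQ := TOfGh n a (SghAt (ctrHalf n) n cK cQ) (tableRedF n (WghAt (ctrHalf n) n x₀ cK cQ))` —
leaf-04's T7-gh v1.1 triple with the completed two-bond table.  The loop weight of leaf R1 (owner R-4 (v): `−2`) is NOT applied.
A DEFINITION; asserts nothing; NOT claimed to be Bałaban's (CHECK-N0). -/
def PghQ (n : ℕ) [NeZero n] (a x₀ cK cQ : ℝ) : Fin 4 → Fin 4 → Site 4 → ℝ :=
  TOfGh n a (SghAt (ctrHalf n) n cK cQ) (tableRedF n (WghAt (ctrHalf n) n x₀ cK cQ))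

/-- [our object] **THE FINE GHOST HESSIAN KERNEL OF THE COMPLETED TRIPLE**:
`fineHessGhQ n a x₀ cK cQ := fineHessA (Ggh n a) (SghAt (ctrHalf n) n cK cQ) (WghAt (ctrHalf n) n x₀ cK cQ)`.  A DEFINITION; asserts nothing. -/
def fineHessGhQ (n : ℕ) [NeZero n] (a x₀ cK cQ : ℝ) : EKer₂ 4 :=
  fineHessA (Ggh n a) (SghAt (ctrHalf n) n cK cQ) (WghAt (ctrHalf n) n x₀ cK cQ)

variable (n : ℕ) [NeZero n] (a x₀ cK cQ : ℝ)

/-- [our object] Unfolding `PghQ`. -/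
theorem PghQ_eq : PghQ n a x₀ cK cQ = TOfGh n a (SghAt (ctrHalf n) n cK cQ) (tableRedF n (WghAt (ctrHalf n) n x₀ cK cQ)) := rfl

/-- [our object] … over the generic leg. -/
theorem PghQ_eq_TOfLeg :
    PghQ n a x₀ cK cQ = TOfLeg n (Ggh n a) (SghAt (ctrHalf n) n cK cQ) (tableRedF n (WghAt (ctrHalf n) n x₀ cK cQ)) := rfl

/-- [our object] … as a `hessKer`. -/
theorem PghQ_eq_hessKer :
    PghQ n a x₀ cK cQ = hessKer (Ggh n a) (vertexRedF n (SghAt (ctrHalf n) n cK cQ)) (tableRedF n (WghAt (ctrHalf n) n x₀ cK cQ)) := rfl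

/-- [our object] Unfolding `fineHessGhQ`. -/
theorem fineHessGhQ_eq : fineHessGhQ n a x₀ cK cQ = fineHessA (Ggh n a) (SghAt (ctrHalf n) n cK cQ) (WghAt (ctrHalf n) n x₀ cK cQ) := rfl

/-- [folklore] The completed table's socket at the centred root, `δ := 1`:
`BiLoc (WghAt c₀ n x₀ cK cQ κ u λ u′) u u′ (|x₀·cK|·e^{1/n} + |−(x₀·cQ·n⁴)|·((8/n³)·e⁸)²) (1/n)`. -/
theorem biLoc_WghAt_ctr (κ : Fin 4) (u : Site 4) (l : Fin 4) (u' : Site 4) :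
    BiLoc (WghAt (ctrHalf n) n x₀ cK cQ κ u l u') u u'
      (|x₀ * cK| * Real.exp (1 / n) + |(-(x₀ * cQ * (n : ℝ) ^ 4))| * (8 / (n : ℝ) ^ 3 * Real.exp (8 * 1)) ^ 2) (1 / n) :=
  biLoc_WghAt n (ctrHalf_mem n) x₀ cK cQ zero_le_one κ u l u'

/-- [folklore] Block covariance of the completed table at the centred root (any root in fact: `WghAt_translate`). -/
theorem WghAt_ctr_translate_block (κ : Fin 4) (u : Site 4) (l : Fin 4) (u' t : Site 4) :
    WghAt (ctrHalf n) n x₀ cK cQ κ (u + (n : ℤ) • t) l (u' + (n : ℤ) • t) = shiftK (-((n : ℤ) • t)) (WghAt (ctrHalf n) n x₀ cK cQ κ u l u') :=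
  WghAt_translate (ctrHalf n) n x₀ cK cQ κ u l u' t

/-- [folklore] The completed table's inversion law at the centred root in leaf-04-g2's `hWr` shape (odd `n`; the sign `(−1)·(−1)` evaluated). -/
theorem WghAt_ctr_pointInversion (hodd : Odd n) (κ : Fin 4) (u : Site 4) (l : Fin 4) (u' : Site 4) :
    WghAt (ctrHalf n) n x₀ cK cQ κ (cInv n κ - u) l (cInv n l - u') = refK (invLeg n) (WghAt (ctrHalf n) n x₀ cK cQ κ u l u') := by
  rw [WghAt_pointInversion n hodd x₀ cK cQ κ u l u']
  norm_num

/-! ## §2 T7 well-typedness of the completed kernel -/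

/-- [folklore] **BLOCK COVARIANCE OF THE COMPLETED DATA** (`0 < a`). -/
theorem blockCovariant_PghQ (ha : 0 < a) :
    BlockCovariant (Ggh n a) (vertexRedF n (SghAt (ctrHalf n) n cK cQ)) (tableRedF n (WghAt (ctrHalf n) n x₀ cK cQ)) n :=
  ⟨fun t => shiftK_Ggh_neg n a ha t,
   fun μ y t => vertexRedF_translate_block n (fun κ' u t => SghAt_ctr_translate_block n cK cQ κ' u t) μ y t,
   fun μ y ν y' t => tableRedF_translate n (fun κ' u l' u' t => WghAt_ctr_translate_block n x₀ cK cQ κ' u l' u' t) μ y ν y' t⟩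

/-- [folklore] **BASE POINT**: `hess (Ggh n a) (vertexRedF n (SghAt …)) (tableRedF n (WghAt …)) μ y ν y′ = PghQ n a x₀ cK cQ μ ν (y′ − y)`. -/
theorem hess_eq_PghQ (ha : 0 < a) (μ : Fin 4) (y : Site 4) (ν : Fin 4) (y' : Site 4) :
    hess (Ggh n a) (vertexRedF n (SghAt (ctrHalf n) n cK cQ)) (tableRedF n (WghAt (ctrHalf n) n x₀ cK cQ)) μ y ν y' =
      PghQ n a x₀ cK cQ μ ν (y' - y) :=
  hess_eq_hessKer (blockCovariant_PghQ n a x₀ cK cQ ha) μ y ν y'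

/-- [folklore] The dressed completed table is a second-order vertex family, with SOME constant and a positive rate (`vertexFamily₂_tableRedF'`). -/
theorem exists_vertexFamily₂_WghAt : ∃ C2 δ2 : ℝ, 0 < δ2 ∧ VertexFamily₂ (tableRedF n (WghAt (ctrHalf n) n x₀ cK cQ)) n C2 δ2 := by
  have hn : (0 : ℝ) < 1 / (n : ℝ) := div_pos one_pos (by exact_mod_cast Nat.pos_of_ne_zero (NeZero.ne n))
  obtain ⟨C2, δ2, hδ2, -, hW⟩ := vertexFamily₂_tableRedF' n (biLoc_WghAt_ctr n x₀ cK cQ) hn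
  exact ⟨C2, δ2, hδ2, hW⟩

/-- [folklore] **T7-gh v1.2 IS WELL-TYPED** — `AbsMoment₂ (PghQ n a x₀ cK cQ μ ν)` for every channel, every block size `n ≥ 1`, every `a > 0`
and all real weights; NO other hypothesis. -/
theorem absMoment₂_PghQ (ha : 0 < a) (μ ν : Fin 4) : AbsMoment₂ (PghQ n a x₀ cK cQ μ ν) := by
  obtain ⟨Cv, δv, hδv, hV⟩ := exists_vertexFamily_SghAt_ctr n cK cQ
  obtain ⟨C2, δ2, hδ2, hW⟩ := exists_vertexFamily₂_WghAt n x₀ cK cQ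
  exact absMoment₂_TOfGh n a ha hV hδv hW hδ2 μ ν

/-- [folklore] **(5.10)-SHAPE DECAY OF EVERY CHANNEL OF T7-gh v1.2**, with SOME constant and positive rate (per `n`):
`∃ C δ, 0 < δ ∧ ∀ μ ν, Decay510 (PghQ n a x₀ cK cQ μ ν) C δ` (`ExpKernelCalculus.hdec_hessKer`, rates matched by monotonicity). -/
theorem exists_decay510_PghQ (ha : 0 < a) : ∃ C δ : ℝ, 0 < δ ∧ ∀ μ ν : Fin 4, Decay510 (PghQ n a x₀ cK cQ μ ν) C δ := by
  have hn1 : 1 ≤ n := NeZero.one_le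
  obtain ⟨Cv, δv, hδv, hV⟩ := exists_vertexFamily_SghAt_ctr n cK cQ
  obtain ⟨C2, δ2, hδ2, hW⟩ := exists_vertexFamily₂_WghAt n x₀ cK cQ
  have hA := decays_Ggh n a ha
  have hrate : 0 < deltaU 4 a / (4 * (n : ℝ)) := by
    have := deltaU_pos 4 ha
    have hn : (0 : ℝ) < n := by exact_mod_cast hn1
    positivity
  set δ' : ℝ := min (deltaU 4 a / (4 * (n : ℝ))) (min δv δ2) with hδ'
  have hδ'pos : 0 < δ' := lt_min hrate (lt_min hδv hδ2)
  have hCv : 0 ≤ Cv := (hV 0 0).nonneg ()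
  have hC2 : 0 ≤ C2 := (hW 0 0 0 0).nonneg ()
  have hA' : Decays (Ggh n a) (2 / min 2 a) δ' := decays_mono hA (const_nonneg a ha) le_rfl (min_le_left _ _)
  have hV' : VertexFamily (vertexRedF n (SghAt (ctrHalf n) n cK cQ)) n Cv δ' := fun μ y =>
    biLoc_mono (hV μ y) hCv ((min_le_right _ _).trans (min_le_left _ _))
  have hW' : VertexFamily₂ (tableRedF n (WghAt (ctrHalf n) n x₀ cK cQ)) n C2 δ' := fun μ y ν y' =>
    biLoc_mono (hW μ y ν y') hC2 ((min_le_right _ _).trans (min_le_right _ _))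
  obtain ⟨C', δ'', hδ'', h⟩ := hdec_hessKer hA' hV' hW' hδ'pos hn1
  exact ⟨C', δ'', hδ'', fun μ ν => h μ ν⟩

/-- [folklore] **T7-gh v1.2 IS AN `ℋ`-SANDWICH** (`0 < a`; NO other hypothesis):
`PghQ n a x₀ cK cQ μ ν z = dressedEntryP (wK n) (fineHessGhQ n a x₀ cK cQ) (n•(−z)) μ ν`. -/
theorem PghQ_eq_dressedEntryP (ha : 0 < a) (μ ν : Fin 4) (z : Site 4) :
    PghQ n a x₀ cK cQ μ ν z = dressedEntryP (wK n) (fineHessGhQ n a x₀ cK cQ) ((n : ℤ) • (-z)) μ ν := by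
  have hn : (0 : ℝ) < 1 / (n : ℝ) := div_pos one_pos (by exact_mod_cast Nat.pos_of_ne_zero (NeZero.ne n))
  rw [PghQ_eq_TOfLeg, fineHessGhQ_eq]
  exact TOfLeg_tableRedF_eq_dressedEntryP_of_block n (Ggh n a) (spr_Ggh n a ha) (shiftK_Ggh_neg n a ha) (biLoc_SghAt_ctr n cK cQ)
    (biLoc_WghAt_ctr n x₀ cK cQ) hn (SghAt_ctr_translate_block n cK cQ) (WghAt_ctr_translate_block n x₀ cK cQ) μ ν z

/-! ## §3 The ENDs -/

/-- [folklore] **A4 FOR T7-gh v1.2, PARITY DISCHARGED — ALL WEIGHTS** (`0 < a`, `n` ODD): the coarse bond second moment of `PghQ` is the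
base-point block average of the fine one GIVEN ONLY the Ward rows `hrow` of `fineHessGhQ` (off the Ward ray `hrow` is a hypothesis; ON the
ray it is `hasSum_row_fineHessGhQ_ray`).  ONE application of leaf-04-g2's generic `bondSecondMoment_TOfGh_ctr_eq_avgM2_of_tableLaw`. -/
theorem bondSecondMoment_PghQ_eq_avgM2_of_wardRows (ha : 0 < a) (hodd : Odd n)
    (hrow : ∀ (κ' l' : Fin 4) (b : Site 4), HasSum (fineHessGhQ n a x₀ cK cQ κ' l' b) 0)
    (κ lam μ ν : Fin 4) :
    ∑' z : Site 4, ((z κ * z lam : ℤ) : ℝ) * ((n : ℝ) ^ 8 * PghQ n a x₀ cK cQ μ ν z)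
      = avgM2 n (fineHessGhQ n a x₀ cK cQ μ ν) κ lam := by
  rw [PghQ_eq, fineHessGhQ_eq]
  exact bondSecondMoment_TOfGh_ctr_eq_avgM2_of_tableLaw n cK cQ a ha hodd (biLoc_WghAt_ctr n x₀ cK cQ)
    (WghAt_ctr_translate_block n x₀ cK cQ) (WghAt_symm (ctrHalf n) n x₀ cK cQ) hrow (WghAt_ctr_pointInversion n x₀ cK cQ hodd) κ lam μ ν

/-- [folklore] **ON THE WARD RAY THE WARD ROWS ARE A THEOREM** (`0 < a`, every `n ≥ 1`, every real `c`):
`∀ κ′ λ′ b, HasSum (fineHessGhQ n a (−c) (c·n²) (c·a) κ′ λ′ b) 0` (this seat's `GhostAveragingSquare.hasSum_row_fineHessA_ghost` at the centred root). -/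
theorem hasSum_row_fineHessGhQ_ray (ha : 0 < a) (c : ℝ) (κ' l' : Fin 4) (b : Site 4) :
    HasSum (fineHessGhQ n a (-c) (c * (n : ℝ) ^ 2) (c * a) κ' l' b) 0 :=
  hasSum_row_fineHessA_ghost n (ctrHalf_mem n) ha c κ' l' b

/-- [folklore] **A4 / K-R5 FOR T7-gh v1.2 ON THE WARD RAY — NO HYPOTHESIS BEYOND `Odd n`, `0 < a`** (every real `c`):
`Σ′_z z_κ z_λ · n⁸ · PghQ n a (−c) (c·n²) (c·a) μ ν z = avgM2 n (fineHessGhQ n a (−c) (c·n²) (c·a) μ ν) κ λ`.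
Proved through leaf-04-g2's SOCKET-ONLY `bondSecondMoment_TOfGh_ctr_eq_avgM2_of_laws` with `hW2 := ward₂_WghAt` — the second kernel
route to `GhostAveragingSquare.bondSecondMoment_TOfGh_eq_avgM2_ghost` (cf. `PghQ_ray_eq_ghost`). -/
theorem bondSecondMoment_PghQ_ray_eq_avgM2 (hodd : Odd n) (ha : 0 < a) (c : ℝ) (κ lam μ ν : Fin 4) :
    ∑' z : Site 4, ((z κ * z lam : ℤ) : ℝ) * ((n : ℝ) ^ 8 * PghQ n a (-c) (c * (n : ℝ) ^ 2) (c * a) μ ν z)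
      = avgM2 n (fineHessGhQ n a (-c) (c * (n : ℝ) ^ 2) (c * a) μ ν) κ lam := by
  rw [PghQ_eq, fineHessGhQ_eq]
  exact bondSecondMoment_TOfGh_ctr_eq_avgM2_of_laws n a ha hodd c (biLoc_WghAt_ctr n (-c) (c * (n : ℝ) ^ 2) (c * a))
    (WghAt_ctr_translate_block n (-c) (c * (n : ℝ) ^ 2) (c * a)) (WghAt_symm (ctrHalf n) n (-c) (c * (n : ℝ) ^ 2) (c * a))
    (fun u l' u' => ward₂_WghAt n (ctrHalf_mem n) (-c) (c * (n : ℝ) ^ 2) (c * a) u l' u')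
    (WghAt_ctr_pointInversion n (-c) (c * (n : ℝ) ^ 2) (c * a) hodd) κ lam μ ν

/-- [folklore] The two kernel routes agree: the ray END in `PghQ`-currency IS this seat's `bondSecondMoment_TOfGh_eq_avgM2_ghost` (by `rfl`
on the objects; recorded so that a cross-reader can check both derivations inhabit one type). -/
theorem PghQ_ray_eq_ghost (hodd : Odd n) (ha : 0 < a) (c : ℝ) (κ lam μ ν : Fin 4) :
    ∑' z : Site 4, ((z κ * z lam : ℤ) : ℝ) * ((n : ℝ) ^ 8 * PghQ n a (-c) (c * (n : ℝ) ^ 2) (c * a) μ ν z)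
      = avgM2 n (fineHessGhQ n a (-c) (c * (n : ℝ) ^ 2) (c * a) μ ν) κ lam :=
  bondSecondMoment_TOfGh_eq_avgM2_ghost n hodd ha c κ lam μ ν

/-- [folklore] **THE RAY END IN `B12Beta.secondMoment` CURRENCY** (`Odd n`, `0 < a`, every real `c`):
`Σ′_z PghQ n a (−c) (c·n²) (c·a) μ ν z · z_κ · z_λ = n⁻⁸ · avgM2 n (fineHessGhQ n a (−c) (c·n²) (c·a) μ ν) κ λ`. -/
theorem secondMoment_PghQ_ray_eq (hodd : Odd n) (ha : 0 < a) (c : ℝ) (κ lam μ ν : Fin 4) :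
    ∑' z : Site 4, PghQ n a (-c) (c * (n : ℝ) ^ 2) (c * a) μ ν z * (z κ : ℝ) * (z lam : ℝ)
      = ((n : ℝ) ^ 8)⁻¹ * avgM2 n (fineHessGhQ n a (-c) (c * (n : ℝ) ^ 2) (c * a) μ ν) κ lam := by
  have hn : (n : ℝ) ≠ 0 := by exact_mod_cast NeZero.ne n
  have h8 : ((n : ℝ) ^ 8)⁻¹ * (n : ℝ) ^ 8 = 1 := inv_mul_cancel₀ (pow_ne_zero 8 hn)
  have h := bondSecondMoment_PghQ_ray_eq_avgM2 n a hodd ha c κ lam μ ν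
  have hre : ∀ z : Site 4, PghQ n a (-c) (c * (n : ℝ) ^ 2) (c * a) μ ν z * (z κ : ℝ) * (z lam : ℝ)
      = ((n : ℝ) ^ 8)⁻¹ * (((z κ * z lam : ℤ) : ℝ) * ((n : ℝ) ^ 8 * PghQ n a (-c) (c * (n : ℝ) ^ 2) (c * a) μ ν z)) := by
    intro z
    rw [Int.cast_mul]
    linear_combination (-(PghQ n a (-c) (c * (n : ℝ) ^ 2) (c * a) μ ν z * (z κ : ℝ) * (z lam : ℝ))) * h8
  rw [tsum_congr hre, tsum_mul_left, h]

end Summit.QuantumFields.BalabanUV.Beta.D1BFx.GhostKernelComplete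

end
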